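import Summits.Ventures.LatticeQCDFlow.Scaling.HubModeGap
import Summits.Ventures.LatticeQCDFlow.Scaling.FlowLadderModeGap

/-!
HONEST FRAMING: exact (Metropolis-corrected) sampling algorithms for lattice gauge theory; figures
of merit are autocorrelation/cost numbers at stated couplings and volumes; no continuum-physics
claim.

# FlowHubModeGap — SECTOR-PRESERVING MAPS ON THE HUB EDGES: THE BALANCED MAP-ASSISTED STAR OVER METASTABLE COLD
# REPLICAS HAS `Gap ≥ p(1−t)γ_A·min{tδ₂, γ₀(1−t)}/(224K²)` WITH `δ₂` THE SECTOR-WISE ACCEPTANCE MASS OF THE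
# MAP-ASSISTED HUB SWAP (`δ₂·min{π̃(B_m), π̃(B_{m∘τ_k})} ≤ Σ_{y∈B_m} min{π̃(y), π̃(edgeFlowSwap φ_k 0 (k+1) y)}`), EVERY
# OTHER CONSTANT UNCHANGED; `τ_int(g) ≤ 224K²/(p(1−t)γ_A·min{tδ₂, γ₀(1−t)}) − ½` FOR EVERY OBSERVABLE
# (lean-2 GEN-22, ours)

Venture-side (OURS).  Cell `lqcd-flow` (pub-lqcd), unit `pub-lqcd-lean-2-g22`, 2026-08-26.  Chapter J, file 4: the
map transfer of `Scaling/HubModeGap` (J3), by the level coordinates of `Scaling/FlowHubSchemeFloor` (I2: the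
map-assisted star `P^φ = t·ptGraphSwap μ e_⋆ φ + (1−t)·prodKernel w M` IS the identity-map star for the pulled-back laws
`ν_0 = μ_0`, `ν_{k+1} = μ_{k+1}∘φ_k` and the conjugated updates, with the same spectral gap) and the sector-preserving
relabelling lemmas of `Scaling/FlowLadderModeGap` (I6).  For SECTOR-PRESERVING bijections `φ_k` (`mode∘φ_k = mode`)
the pulled-back cold laws have the same sector weights, the conjugated updates the same within-sector Poincaré
constants, the hot level is untouched, and the sector-wise plain-swap overlap of the pulled-back laws is the
sector-wise ACCEPTANCE MASS of the map-assisted hub swap — so J3's floor holds for `P^φ` with that `δ₂` and nothing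
else changed.  This is the hub twin of I6 (`Scaling/FlowLadderModeGap`, adjacent ladder, `p q^K`, order `K⁻⁴`): on
the hub the order is `K⁻²` and the persistence is ONE-SIDED.

## What is proved

* §1 `starLevel_mode` (sector-preserving maps ⇒ sector-preserving level coordinates), **`hubModeOverlap_relabel`**
  (`Σ_{x∈B_m} min{ν̃(x), ν̃(x∘τ_k)} = Σ_{y∈B_m} min{π̃(y), π̃(edgeFlowSwap φ_k 0 (k+1) y)}`).
* §2 **`flowHubMode_spectralGap_ge`** — balanced weights `w_0 = ½`, `w_{k+1} = 1/(2K)`, sector-preserving `φ`,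
  one-sided persistence `p`, within-sector `γ_A`, hot global Poincaré constant `γ₀`, sector-wise map-swap acceptance
  `δ₂`: `Gap(P^φ) ≥ p(1−t)γ_A·min{tδ₂, γ₀(1−t)}/(224K²)`.
* §3 **`flowHubMode_tauInt_le`** — hot update irreducible ⇒ `τ_int(g) ≤ 224K²/(p(1−t)γ_A·min{tδ₂, γ₀(1−t)}) − ½`
  for every non-constant observable.

Reading (no numerics implied): a flow trained between the hot coupling and each cold coupling that respects the
topological sectors cannot move weight between sectors, but it drives the sector-wise hub-swap acceptance `δ₂` towards
one; the hub then relaxes in order `K²/(pγ_Aγ₀)` sampler steps however metastable the cold levels are, the only trace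
of the sector-weight barrier being the heating persistence `p`.  NOT CLAIMED: maps that are not sector-preserving
(the ceilings of `Scaling/FlowHubEquivariantCeiling` apply); non-bijective or stochastic maps; continuous configuration
spaces (Jacobians); anything measured.  Literature grade (cell rule): OWN MECHANISM (level coordinates) on a KNOWN
decomposition, NEW TYPING; nothing cited as a fact; no new bib keys.
-/

noncomputable section

open Finset Function
open Literature.Probability.MarkovChains
open Literature.Probability.MarkovChains.Decomposition

namespace Summit.Ventures.LatticeQCDFlow.Scaling

section FlowHubMode

variable {S J : Type*} [Fintype S] [DecidableEq S] [Fintype J] [DecidableEq J] {K : ℕ}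
  {μ : Fin (K + 1) → S → ℝ} {M : Fin (K + 1) → S → S → ℝ} {mode : S → J} {t : ℝ} (φ : Fin K → Equiv.Perm S)

/-! ## §1 Sector-preserving level coordinates on the star -/

omit [Fintype S] [DecidableEq S] [Fintype J] [DecidableEq J] in
/-- Sector-preserving hub maps give sector-preserving level coordinates: `mode∘L_i = mode` for
`L = (1, φ_0⁻¹, …, φ_{K−1}⁻¹)`. [ours] -/
theorem starLevel_mode (hφmode : ∀ (k : Fin K) (u : S), mode (φ k u) = mode u) (i : Fin (K + 1)) (u : S) :
    mode ((Fin.cons (Equiv.refl S) (fun k => (φ k).symm) : Fin (K + 1) → Equiv.Perm S) i u) = mode u := by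
  induction i using Fin.cases with
  | zero => rw [starLevel_zero]; rfl
  | succ k =>
    rw [starLevel_succ]
    have h := hφmode k ((φ k).symm u)
    rw [Equiv.apply_symm_apply] at h
    exact h.symm

omit [Fintype S] [DecidableEq S] [Fintype J] [DecidableEq J] in
/-- The inverse level coordinates are sector-preserving too. [ours] -/
theorem starLevel_symm_mode (hφmode : ∀ (k : Fin K) (u : S), mode (φ k u) = mode u) (i : Fin (K + 1)) (u : S) :
    mode (((Fin.cons (Equiv.refl S) (fun k => (φ k).symm) : Fin (K + 1) → Equiv.Perm S) i).symm u) = mode u := by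
  have h := starLevel_mode φ hφmode i
    (((Fin.cons (Equiv.refl S) (fun k => (φ k).symm) : Fin (K + 1) → Equiv.Perm S) i).symm u)
  rw [Equiv.apply_symm_apply] at h
  exact h.symm

omit [DecidableEq S] [Fintype J] in
/-- **The sector-wise plain-swap overlap of the pulled-back laws is the sector-wise acceptance mass of the
map-assisted hub swap:** `Σ_{x∈B_m} min{ν̃(x), ν̃(x∘τ_k)} = Σ_{y∈B_m} min{π̃(y), π̃(edgeFlowSwap φ_k 0 (k+1) y)}`.
[ours] -/
theorem hubModeOverlap_relabel (hφmode : ∀ (k : Fin K) (u : S), mode (φ k u) = mode u)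
    (m : Fin (K + 1) → J) (k : Fin K) :
    ∑ x ∈ block (fun z : Fin (K + 1) → S => mode ∘ z) m,
        min (tensorFun (fun i u => μ i (((Fin.cons (Equiv.refl S) (fun k => (φ k).symm) :
            Fin (K + 1) → Equiv.Perm S) i).symm u)) x)
          (tensorFun (fun i u => μ i (((Fin.cons (Equiv.refl S) (fun k => (φ k).symm) :
            Fin (K + 1) → Equiv.Perm S) i).symm u)) (x ∘ Equiv.swap (0 : Fin (K + 1)) k.succ))
      = ∑ y ∈ block (fun z : Fin (K + 1) → S => mode ∘ z) m,
          min (tensorFun μ y) (tensorFun μ (edgeFlowSwap (φ k) 0 k.succ y)) := by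
  set L : Fin (K + 1) → Equiv.Perm S := Fin.cons (Equiv.refl S) (fun k => (φ k).symm) with hL
  have hLmode : ∀ (i : Fin (K + 1)) (u : S), mode (L i u) = mode u := starLevel_mode φ hφmode
  have hΨ : ∀ z : Fin (K + 1) → S,
      (fun z : Fin (K + 1) → S => mode ∘ z) (Equiv.piCongrRight L z) = (fun z : Fin (K + 1) → S => mode ∘ z) z :=
    fun z => by funext i; simp [hLmode]
  rw [← sum_block_relabel (Equiv.piCongrRight L) hΨ m (fun x => min (tensorFun (fun i u => μ i ((L i).symm u)) x)
    (tensorFun (fun i u => μ i ((L i).symm u)) (x ∘ Equiv.swap (0 : Fin (K + 1)) k.succ)))]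
  refine sum_congr rfl fun y _ => ?_
  have e1 : tensorFun (fun i u => μ i ((L i).symm u)) (Equiv.piCongrRight L y) = tensorFun μ y :=
    (tensorFun_relabel L μ y).symm
  have e2 : tensorFun (fun i u => μ i ((L i).symm u)) ((Equiv.piCongrRight L y) ∘ Equiv.swap (0 : Fin (K + 1)) k.succ)
      = tensorFun μ (edgeFlowSwap (φ k) 0 k.succ y) := by
    rw [show (Equiv.piCongrRight L y) ∘ Equiv.swap (0 : Fin (K + 1)) k.succ
        = fun i => L i (edgeFlowSwap (φ k) 0 k.succ y i) from (starRelabel_edgeFlowSwap φ y k).symm,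
      ← tensorFun_relabel L μ]
  simp only [e1, e2]

/-! ## §2 The mode-gap floor for the map-assisted balanced star -/

/-- **THE MODE-GAP FLOOR FOR THE HUB WITH SECTOR-PRESERVING MAPS:** for bijections `φ_k` on the hub edges with
`mode(φ_k u) = mode(u)`, balanced weights `w_0 = ½`, `w_{k+1} = 1/(2K)` (`K ≥ 1`, `|S| ≥ 2`, `0 < t < 1`), one-sided
persistence `p` of the sector weights, within-sector Poincaré constant `γ_A`, hot global Poincaré constant `γ₀`, and
the sector-wise acceptance mass `δ₂` of the map-assisted hub swaps
(`δ₂·min{π̃(B_m), π̃(B_{m∘τ_k})} ≤ Σ_{y ∈ B_m} min{π̃(y), π̃(edgeFlowSwap φ_k 0 (k+1) y)}`):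
`Gap(P^φ) ≥ p(1−t)γ_A·min{tδ₂, γ₀(1−t)}/(224K²)`. [ours] -/
theorem flowHubMode_spectralGap_ge [Nontrivial S] (hφmode : ∀ (k : Fin K) (u : S), mode (φ k u) = mode u)
    (hμ : ∀ k x, 0 < μ k x) (hμ1 : ∀ k, ∑ x, μ k x = 1) (hmode : Function.Surjective mode) (hK : 1 ≤ K)
    (hM : ∀ k, IsRowStochastic (M k)) (hMrev : ∀ k, DetailedBalance (μ k) (M k)) (ht0 : 0 < t) (ht1 : t < 1)
    {p δ₂ γ₀ γA : ℝ} (hp : 0 < p) (hp1 : p ≤ 1) (hδ0 : 0 < δ₂) (hδ1 : δ₂ ≤ 1) (hγ₀ : 0 < γ₀) (hγA : 0 < γA)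
    (hγA1 : γA ≤ 1)
    (hpers : ∀ (k : Fin K) (j : J), p * blockMass (μ k.succ) mode j ≤ blockMass (μ 0) mode j)
    (hδ : ∀ (i : Fin (K + 1) → J) (k : Fin K), i ∘ Equiv.swap (0 : Fin (K + 1)) k.succ ≠ i →
      δ₂ * min (blockMass (tensorFun μ) (fun z : Fin (K + 1) → S => mode ∘ z) i)
          (blockMass (tensorFun μ) (fun z : Fin (K + 1) → S => mode ∘ z) (i ∘ Equiv.swap (0 : Fin (K + 1)) k.succ))
        ≤ ∑ y ∈ block (fun z : Fin (K + 1) → S => mode ∘ z) i,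
            min (tensorFun μ y) (tensorFun μ (edgeFlowSwap (φ k) 0 k.succ y)))
    (hgap0 : ∀ h : S → ℝ, γ₀ * lawVariance (μ 0) h ≤ dirichletForm (μ 0) (M 0) h)
    (hgapA : ∀ k j, ∀ h : S → ℝ, γA * lawVariance (blockLaw (μ k) mode j) h
      ≤ dirichletForm (blockLaw (μ k) mode j) (restrictionChain (M k) mode) h) :
    p * (1 - t) * γA * min (t * δ₂) (γ₀ * (1 - t)) / (224 * K ^ 2)
      ≤ spectralGap (tensorFun μ) (fun x y : Fin (K + 1) → S =>
          t * ptGraphSwap μ (fun k : Fin K => ((0 : Fin (K + 1)), k.succ)) φ x y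
            + (1 - t) * prodKernel (fun k : Fin (K + 1) => if k = 0 then (1 : ℝ) / 2 else 1 / (2 * K)) M x y) := by
  rw [flowStar_spectralGap_eq φ hμ t]
  set L : Fin (K + 1) → Equiv.Perm S := Fin.cons (Equiv.refl S) (fun k => (φ k).symm) with hL
  have hLmode : ∀ (i : Fin (K + 1)) (u : S), mode (L i u) = mode u := starLevel_mode φ hφmode
  have hLmode' : ∀ (i : Fin (K + 1)) (u : S), mode ((L i).symm u) = mode u := starLevel_symm_mode φ hφmode
  have hL0u : ∀ u, (L 0).symm u = u := fun u => by rw [hL, starLevel_zero]; rfl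
  have hν0 : (fun u => μ 0 ((L 0).symm u)) = μ 0 := funext fun u => by rw [hL0u]
  have hM0 : (fun u v => M 0 ((L 0).symm u) ((L 0).symm v)) = M 0 := funext fun u => funext fun v => by rw [hL0u, hL0u]
  -- block masses of the pulled-back levels are those of `μ`
  have hbm : ∀ (k : Fin (K + 1)) (j : J), blockMass (fun u => μ k ((L k).symm u)) mode j = blockMass (μ k) mode j :=
    fun k j => blockMass_relabel (L k).symm (hLmode' k) (μ k) j
  refine hubModeBalanced_spectralGap_ge_of_hotGap (μ := fun i u => μ i ((L i).symm u))
    (M := fun i u v => M i ((L i).symm u) ((L i).symm v)) (mode := mode) (fun k u => hμ k _)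
    (fun k => by rw [Equiv.sum_comp (L k).symm (μ k)]; exact hμ1 k) hmode hK
    (fun k => ⟨fun u v => (hM k).1 _ _, fun u => ?_⟩) (fun k u v => hMrev k _ _) ht0 ht1 hp hp1 hδ0 hδ1 hγ₀ hγA hγA1
    (fun k j => by rw [hbm, hbm]; exact hpers k j) (fun i k hik => ?_) ?_ (fun k j h => ?_)
  · simpa using (Equiv.sum_comp (L k).symm (fun v => M k ((L k).symm u) v)).trans ((hM k).2 _)
  · rw [blockMass_tensorFun_relabel L hLmode, blockMass_tensorFun_relabel L hLmode, hubModeOverlap_relabel φ hφmode]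
    exact hδ i k hik
  · intro h
    have e1 : lawVariance (fun u => μ 0 ((L 0).symm u)) h = lawVariance (μ 0) h := by rw [hν0]
    have e2 : dirichletForm (fun u => μ 0 ((L 0).symm u)) (fun u v => M 0 ((L 0).symm u) ((L 0).symm v)) h
        = dirichletForm (μ 0) (M 0) h := by rw [hν0, hM0]
    rw [e1, e2]; exact hgap0 h
  · exact blockPoincare_relabel (L k).symm (hLmode' k) j (hgapA k j) h

/-! ## §3 Every observable -/

/-- **EVERY OBSERVABLE: `τ_int(g) ≤ 224K²/(p(1−t)γ_A·min{tδ₂, γ₀(1−t)}) − ½`** for the balanced star with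
sector-preserving maps on the hub edges and an irreducible hot update (`asympVar(g)/(2Var(g)) ≤ …`; one step = one
swap attempt or one replica update). [ours] -/
theorem flowHubMode_tauInt_le [Nontrivial S] (hφmode : ∀ (k : Fin K) (u : S), mode (φ k u) = mode u)
    (hμ : ∀ k x, 0 < μ k x) (hμ1 : ∀ k, ∑ x, μ k x = 1) (hmode : Function.Surjective mode) (hK : 1 ≤ K)
    (hM : ∀ k, IsRowStochastic (M k)) (hMrev : ∀ k, DetailedBalance (μ k) (M k)) (hM0 : IsIrreducible (M 0))
    (ht0 : 0 < t) (ht1 : t < 1)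
    {p δ₂ γ₀ γA : ℝ} (hp : 0 < p) (hp1 : p ≤ 1) (hδ0 : 0 < δ₂) (hδ1 : δ₂ ≤ 1) (hγ₀ : 0 < γ₀) (hγA : 0 < γA)
    (hγA1 : γA ≤ 1)
    (hpers : ∀ (k : Fin K) (j : J), p * blockMass (μ k.succ) mode j ≤ blockMass (μ 0) mode j)
    (hδ : ∀ (i : Fin (K + 1) → J) (k : Fin K), i ∘ Equiv.swap (0 : Fin (K + 1)) k.succ ≠ i →
      δ₂ * min (blockMass (tensorFun μ) (fun z : Fin (K + 1) → S => mode ∘ z) i)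
          (blockMass (tensorFun μ) (fun z : Fin (K + 1) → S => mode ∘ z) (i ∘ Equiv.swap (0 : Fin (K + 1)) k.succ))
        ≤ ∑ y ∈ block (fun z : Fin (K + 1) → S => mode ∘ z) i,
            min (tensorFun μ y) (tensorFun μ (edgeFlowSwap (φ k) 0 k.succ y)))
    (hgap0 : ∀ h : S → ℝ, γ₀ * lawVariance (μ 0) h ≤ dirichletForm (μ 0) (M 0) h)
    (hgapA : ∀ k j, ∀ h : S → ℝ, γA * lawVariance (blockLaw (μ k) mode j) h
      ≤ dirichletForm (blockLaw (μ k) mode j) (restrictionChain (M k) mode) h)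
    {g : (Fin (K + 1) → S) → ℝ} (hg : 0 < lawVariance (tensorFun μ) g) :
    asympVar g (tensorFun μ) (fun x y : Fin (K + 1) → S =>
        t * ptGraphSwap μ (fun k : Fin K => ((0 : Fin (K + 1)), k.succ)) φ x y
          + (1 - t) * prodKernel (fun k : Fin (K + 1) => if k = 0 then (1 : ℝ) / 2 else 1 / (2 * K)) M x y)
      / (2 * lawVariance (tensorFun μ) g)
      ≤ 224 * K ^ 2 / (p * (1 - t) * γA * min (t * δ₂) (γ₀ * (1 - t))) - 1 / 2 := by
  have hKr : (1 : ℝ) ≤ K := by exact_mod_cast hK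
  have hw0 : ∀ k : Fin (K + 1), 0 ≤ (if k = 0 then (1 : ℝ) / 2 else 1 / (2 * K)) := fun k => by
    split_ifs <;> positivity
  have h1t : 0 < 1 - t := by linarith
  have hm : 0 < min (t * δ₂) (γ₀ * (1 - t)) := lt_min (by positivity) (by positivity)
  have hc0 : 0 < p * (1 - t) * γA * min (t * δ₂) (γ₀ * (1 - t)) / (224 * K ^ 2) := by positivity
  have h := tauInt_le_of_gapFloor (tensorFun_pos hμ) (sum_tensorFun_eq_one μ hμ1)
    (weightedScheme_isRowStochastic (ptGraphSwap_isRowStochastic hμ) hM hw0 (balancedWeight_sum hK) ht0.le ht1.le)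
    (weightedScheme_detailedBalance (ptGraphSwap_detailedBalance hμ) hMrev t)
    (flowStar_isIrreducible_of_hot φ hμ hM hM0 hw0 (balancedWeight_sum hK) (by simp) ht0 ht1) hc0
    (flowHubMode_spectralGap_ge φ hφmode hμ hμ1 hmode hK hM hMrev ht0 ht1 hp hp1 hδ0 hδ1 hγ₀ hγA hγA1 hpers hδ hgap0
      hgapA) hg
  rw [one_div_div] at h
  exact h

end FlowHubMode

end Summit.Ventures.LatticeQCDFlow.Scaling

end
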